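import Mathlib.Analysis.Normed.Ring.Finite
import Literature.NumberTheory.LFunctions.UniformClassGroupPNT
import Literature.NumberTheory.LFunctions.AbelianFrobeniusDensity
import HarnessLib

/-!
# Class group `L`-functions: holomorphy off `s = 1` and the inversion formula
# `ζ(𝔎, s) = h⁻¹ Σ_χ χ(𝔎⁻¹) L(s, χ)`

Topic `Literature/NumberTheory/LFunctions` (namespace `Literature.NumberTheory.LFunctions.NumberField`,
continuing `UniformClassGroupPNT.lean`, which defines the `L`-function
`classGroupLFunction K χ s = Σ_{𝔎 ∈ Cl_K} χ(𝔎) ζ(𝔎, s)` of a class group character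
`χ : Cl_K →* ℂˣ` through the continued partial zeta functions `ζ(𝔎, s) = classSumCont 𝔎 s` of
`DedekindZetaClassSumCont.lean`, Neukirch VII (5.9)–(5.11), and proves that it is the Dirichlet
series `Σ_{𝔞 ≠ 0} χ([𝔞]) 𝔑𝔞^{-s}` for `Re s > 1`, `classGroupLFunction_eq_tsum`). Everything here is
PROVED (theorems only; no definitions, no named facts):

* `differentiableOn_classGroupLFunction` — `L(s, χ)` is holomorphic on `ℂ ∖ {1}`;
* the characters of `Cl_K` are enumerated through Mathlib's additive characters
  `ψ : AddChar (Additive Cl_K) ℂ` of the additive copy of the class group (for which Mathlib has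
  `|Ĉl_K| = h_K`, `AddChar.card_eq`, and the orthogonality relation `Σ_ψ ψ(a) = h·[a = 0]`,
  `AddChar.sum_apply_eq_ite`), via the tree's `AbelianDensity.toMulHom ψ : Cl_K →* ℂ`
  (`AbelianFrobeniusDensity.lean`) and Mathlib's `MonoidHom.toHomUnits`:
  `toHomUnits_toMulHom_apply`, `toHomUnits_toMulHom_injective`, `toHomUnits_toMulHom_inv`,
  `exists_toHomUnits_toMulHom_eq` (every `χ : Cl_K →* ℂˣ` arises), `sum_classGroupChar_apply_eq_ite`
  (`Σ_ψ ψ(𝔎) = h·[𝔎 = 1]`);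
* `sum_apply_inv_mul_classGroupLFunction` — **orthogonality against the partial zeta functions**:
  `Σ_ψ ψ(𝔎⁻¹) L(s, ψ) = h · ζ(𝔎, s)` for every class `𝔎` and every `s`;
* `classSumCont_eq_sum_classGroupLFunction` — **inversion**: `ζ(𝔎, s) = h⁻¹ Σ_ψ ψ(𝔎⁻¹) L(s, ψ)`
  (finite Fourier inversion on `Cl_K`). For an imaginary quadratic field and `𝔎 = [𝔞_Q]⁻¹` the class
  attached to a form `Q`, the left side is `½ ζ_Q(s)` (`QuadraticFields/IdealClassEpsteinContinuation.lean`),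
  and this is the decomposition "`ζ(s, A) = h⁻¹ Σ_χ χ̄(A) L(s, χ)`" of the zeta-function of an ideal
  class into class group `L`-functions (Zagier, *Zetafunktionen und quadratische Körper*, §8;
  Davenport–Heilbronn 1936, Voronin 1976 and Bauer 2003 as reported by Steuding,
  *Value-Distribution of L-Functions*, p. 235), here for the continued functions.

## References

* [NeukirchANT1999] J. Neukirch, *Algebraic Number Theory*, Springer 1999, Ch. VII (5.9)–(5.11),
  (6.8), §8.
* D. B. Zagier, *Zetafunktionen und quadratische Körper*, Springer 1981, §8.
* [Steuding2007] J. Steuding, *Value-Distribution of L-Functions*, LNM 1877, Springer 2007, p. 235.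
-/

noncomputable section

open scoped NumberField nonZeroDivisors
open NumberField Complex Filter Topology Set
open Literature.NumberTheory.LFunctions.AbelianDensity (toMulHom toMulHom_apply)

namespace Literature.NumberTheory.LFunctions.NumberField

variable {K : Type*} [Field K] [NumberField K]

/-! ### Holomorphy -/

/-- **`L(s, χ)` is holomorphic on `ℂ ∖ {1}`** (a finite combination of the continued partial zeta
functions `classSumCont`, `differentiableOn_classSumCont`). [cite: NeukirchANT1999, Ch. VII (5.10)] -/
theorem differentiableOn_classGroupLFunction (χ : ClassGroup (𝓞 K) →* ℂˣ) :
    DifferentiableOn ℂ (classGroupLFunction K χ) {1}ᶜ := by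
  have : classGroupLFunction K χ = fun s ↦
      ∑ C : ClassGroup (𝓞 K), (χ C : ℂ) * classSumCont (thetaIdeal_inv_holds K) C s := by
    funext s; rw [classGroupLFunction]
  rw [this]
  exact DifferentiableOn.fun_sum fun C _ ↦
    (differentiableOn_const _).mul (differentiableOn_classSumCont (thetaIdeal_inv_holds K) C)

/-- `L(·, χ)` is differentiable at every `s ≠ 1`. [cite: NeukirchANT1999, Ch. VII (5.10)] -/
theorem differentiableAt_classGroupLFunction (χ : ClassGroup (𝓞 K) →* ℂˣ) {s : ℂ} (hs : s ≠ 1) :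
    DifferentiableAt ℂ (classGroupLFunction K χ) s :=
  (differentiableOn_classGroupLFunction χ).differentiableAt (isOpen_compl_singleton.mem_nhds hs)

/-! ### The characters of `Cl_K` through the additive characters of `Additive Cl_K` -/

omit [NumberField K] in
/-- Values: `(toMulHom ψ).toHomUnits 𝔎 = ψ(𝔎)`. [folklore] -/
theorem toHomUnits_toMulHom_apply (ψ : AddChar (Additive (ClassGroup (𝓞 K))) ℂ)
    (C : ClassGroup (𝓞 K)) : ((toMulHom ψ).toHomUnits C : ℂ) = ψ (Additive.ofMul C) := rfl

omit [NumberField K] in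
/-- `ψ ↦ (toMulHom ψ).toHomUnits` is injective. [folklore] -/
theorem toHomUnits_toMulHom_injective :
    Function.Injective fun ψ : AddChar (Additive (ClassGroup (𝓞 K))) ℂ ↦ (toMulHom ψ).toHomUnits := by
  intro ψ₁ ψ₂ h
  refine DFunLike.ext ψ₁ ψ₂ fun a ↦ ?_
  have := congrArg (fun χ : ClassGroup (𝓞 K) →* ℂˣ ↦ (χ (Additive.toMul a) : ℂ)) h
  simpa [toHomUnits_toMulHom_apply] using this

omit [NumberField K] in
/-- Compatibility with inverses: `(toMulHom ψ⁻¹).toHomUnits = ((toMulHom ψ).toHomUnits)⁻¹`.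
[folklore] -/
theorem toHomUnits_toMulHom_inv (ψ : AddChar (Additive (ClassGroup (𝓞 K))) ℂ) :
    (toMulHom ψ⁻¹).toHomUnits = ((toMulHom ψ).toHomUnits)⁻¹ := by
  refine MonoidHom.ext fun C ↦ Units.ext ?_
  rw [toHomUnits_toMulHom_apply, AddChar.inv_apply, MonoidHom.inv_apply, Units.val_inv_eq_inv_val,
    toHomUnits_toMulHom_apply, ← AddChar.map_neg_eq_inv]

omit [NumberField K] in
/-- Every class group character `χ : Cl_K →* ℂˣ` is `(toMulHom ψ).toHomUnits` for the additive
character `ψ(a) = χ(a)`. [folklore] -/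
theorem exists_toHomUnits_toMulHom_eq (χ : ClassGroup (𝓞 K) →* ℂˣ) :
    ∃ ψ : AddChar (Additive (ClassGroup (𝓞 K))) ℂ, (toMulHom ψ).toHomUnits = χ := by
  refine ⟨⟨fun a ↦ (χ (Additive.toMul a) : ℂ), by simp, fun a b ↦ by simp⟩, ?_⟩
  refine MonoidHom.ext fun C ↦ Units.ext ?_
  rw [toHomUnits_toMulHom_apply]
  rfl

/-- `|Additive Cl_K| = |Cl_K|`. [folklore] -/
theorem card_additive_classGroup :
    Fintype.card (Additive (ClassGroup (𝓞 K))) = Fintype.card (ClassGroup (𝓞 K)) :=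
  Fintype.card_congr Additive.toMul

variable (K) in
/-- **There are `h_K` class group characters**: `|Ĉl_K| = h_K`. [folklore] -/
theorem card_addChar_classGroup :
    Fintype.card (AddChar (Additive (ClassGroup (𝓞 K))) ℂ) = classNumber K := by
  rw [AddChar.card_eq, card_additive_classGroup]
  rfl

open scoped Classical in
/-- **Orthogonality**: `Σ_ψ ψ(𝔎) = h·[𝔎 = 1]`, `h = h_K` (Mathlib's `AddChar.sum_apply_eq_ite`).
[folklore] -/
theorem sum_classGroupChar_apply_eq_ite (C : ClassGroup (𝓞 K)) :
    ∑ ψ : AddChar (Additive (ClassGroup (𝓞 K))) ℂ, ψ (Additive.ofMul C) =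
      if C = 1 then (Fintype.card (ClassGroup (𝓞 K)) : ℂ) else 0 := by
  rw [AddChar.sum_apply_eq_ite, card_additive_classGroup]
  by_cases hC : C = 1
  · rw [if_pos hC, if_pos (ofMul_eq_zero.2 hC)]
  · rw [if_neg hC, if_neg (mt ofMul_eq_zero.1 hC)]

/-! ### Inversion -/

/-- **Orthogonality against the partial zeta functions**:
`Σ_ψ ψ(𝔎⁻¹) L(s, ψ) = h · ζ(𝔎, s)` (`h = h_K`), since `Σ_ψ ψ(𝔎⁻¹ 𝔎') = h·[𝔎' = 𝔎]`.
[cite: NeukirchANT1999, Ch. VII §8] -/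
theorem sum_apply_inv_mul_classGroupLFunction (C : ClassGroup (𝓞 K)) (s : ℂ) :
    ∑ ψ : AddChar (Additive (ClassGroup (𝓞 K))) ℂ,
        ψ (Additive.ofMul C⁻¹) * classGroupLFunction K (toMulHom ψ).toHomUnits s =
      (Fintype.card (ClassGroup (𝓞 K)) : ℂ) * classSumCont (thetaIdeal_inv_holds K) C s := by
  classical
  simp_rw [classGroupLFunction, toHomUnits_toMulHom_apply, Finset.mul_sum]
  rw [Finset.sum_comm]
  have key : ∀ C' : ClassGroup (𝓞 K),
      ∑ ψ : AddChar (Additive (ClassGroup (𝓞 K))) ℂ, ψ (Additive.ofMul C⁻¹) *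
          (ψ (Additive.ofMul C') * classSumCont (thetaIdeal_inv_holds K) C' s) =
        (if C = C' then (Fintype.card (ClassGroup (𝓞 K)) : ℂ) else 0) *
          classSumCont (thetaIdeal_inv_holds K) C' s := by
    intro C'
    simp_rw [← mul_assoc, ← AddChar.map_add_eq_mul]
    rw [← Finset.sum_mul, ← ofMul_mul, sum_classGroupChar_apply_eq_ite]
    by_cases hC : C = C'
    · rw [if_pos hC, if_pos (inv_mul_eq_one.2 hC)]
    · rw [if_neg hC, if_neg (mt inv_mul_eq_one.1 hC)]
  simp_rw [key, ite_mul, zero_mul]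
  rw [Finset.sum_ite_eq Finset.univ C, if_pos (Finset.mem_univ C)]

/-- **Inversion: `ζ(𝔎, s) = h⁻¹ Σ_ψ ψ(𝔎⁻¹) L(s, ψ)`** for every class `𝔎` and every `s`
(`ψ(𝔎⁻¹) = ψ̄(𝔎)`): finite Fourier inversion on `Cl_K`. For an imaginary quadratic field and
`𝔎 = [𝔞_Q]⁻¹` the left side is `½ ζ_Q(s)`, Zagier's "`ζ(s, A) = h⁻¹ Σ_χ χ̄(A) L(s, χ)`" for the
continued functions. [cite: NeukirchANT1999, Ch. VII §8] -/
theorem classSumCont_eq_sum_classGroupLFunction (C : ClassGroup (𝓞 K)) (s : ℂ) :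
    classSumCont (thetaIdeal_inv_holds K) C s =
      (Fintype.card (ClassGroup (𝓞 K)) : ℂ)⁻¹ *
        ∑ ψ : AddChar (Additive (ClassGroup (𝓞 K))) ℂ,
          ψ (Additive.ofMul C⁻¹) * classGroupLFunction K (toMulHom ψ).toHomUnits s := by
  rw [sum_apply_inv_mul_classGroupLFunction, ← mul_assoc, inv_mul_cancel₀, one_mul]
  exact_mod_cast Fintype.card_ne_zero

end Literature.NumberTheory.LFunctions.NumberField
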